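import Summits.CriticalPhenomena.PercolationContinuityZ3.Theorems.Transplant.AutPolynomialGrowthEndState
import Summits.CriticalPhenomena.PercolationContinuityZ3.Theorems.Transplant.BenjaminiSchrammResidue
import HarnessLib

/-!
# The END-STATE input has a BOUNDEDLY GENERATED kernel off exponential growth of the orbit Rips graph — in particular on every graph of polynomial
# growth (the (κ′)-readiness of the end-state data; relative Milnor lemma on the orbit Rips graph)

builds on p205010 (kernel theorem, internal audit signed; external expert review pending) — nothing in this file uses p205010; UNCONDITIONAL (no node; Trofimov's
theorem is NOT used here).  Lane `prim-bschramm`, seat `prim-bschramm-p4` gen 27 (PART C3 of `P4-GENERAL.md` §49.9).  Helper file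
(`--supports stmt-CriticalPhenomena-4575 --as helper`).  Def-free.

THE POINT.  A multi-type quasi-step frames node needs, besides the chart data of `EndStateChart.exists_quasiChart` (gen 27, no growth hypothesis), a cylinder
clause (κ′), whose source in every instance so far is: `ker c` is generated by elements of BOUNDED DISPLACEMENT (gen 25's relative Milnor lemma
`AutMilnor.ker_eq_closure_bounded`, stated for a group generated by finitely many elements and a vertex stabiliser on a graph that grows subexponentially at that
vertex).  For the END-STATE input (finitely many orbits, stabilisers arbitrary) the group acts TRANSITIVELY on the orbit Rips graph of one orbit (gen 25's
`AutChart.orbitRips`), where it is generated by the movers to Rips-neighbours and the stabiliser (`AutChart.closure_movers_eq_top`), and polynomial growth of `G`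
passes to the orbit Rips graph (`AutPoly.orbitRips_polynomialGrowth`).  Hence:
* **`EndStateKernel.map_stabilizer_eq_one_all`** — killing ONE vertex stabiliser kills ALL (no orbit hypothesis): the end-state input may be stated with gen 25's
  one-vertex stabiliser condition;
* **`EndStateKernel.ker_eq_closure_bounded`** — `A` acting by automorphisms on a connected locally finite `G` WITHOUT exponential growth, with finitely many
  orbits, `c : A → ℤ²` killing `Stab(t)` ⟹ `ker c = ⟨{g ∈ ker c : d_G(g • t, t) ≤ M}⟩` for some `M` (subexponential scales at `t` from the finitely many orbits,
  `subexp_of_not_hasExponentialGrowth`; they pass to the orbit Rips graph, `|B_Rips(t,k)| ≤ |B_G(t,(2R+1)k)|`; then the cobounded core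
  `ker_eq_closure_bounded_of_cobounded`);
* **`EndStateKernel.ker_eq_closure_bounded_of_polynomialGrowth`** — the same on every graph of POLYNOMIAL growth (`|B(x,n)| ≤ C (n+1)^D`).
So on the polynomial-growth class EVERY hypothesis-side ingredient of an end-state interface — input (`AutPoly.exists_finiteOrbits_rankTwo`, modulo Trofimov),
chart/frames/quasi-steps (`EndStateChart.exists_quasiChart`), bounded generation of the kernel (this file) — is kernel; what such a node must PROVE is the drop
statement itself.  Nothing is claimed about any open node.
[cite: MilnorSolvableGrowth1968, Lemma 1 pp. 447–448] [cite: BenjaminiSchramm1996, §2 (almost transitive graphs)] [cite: Hutchcroft2016, §1 (exponential growth)]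
-/

noncomputable section

namespace Summit.CriticalPhenomena.PercolationContinuityZ3.Theorems.Transplant

open SimpleGraph Literature.Barriers.CriticalPhenomena Literature.Probability.LatticeModels Literature.Probability.Percolation
open scoped Classical

namespace EndStateKernel

variable {V : Type} {G : SimpleGraph V} [G.LocallyFinite] {A : Type} [Group A] [MulAction A V]

/-- **Killing ONE vertex stabiliser kills them ALL** (connected graph, action by automorphisms, no orbit hypothesis): an element fixing `w` moves `t` into the
finite ball `B(w, d(w,t))`, so the `c`-image of `Stab(w)` is finite, hence trivial in the torsion-free `ℤ²`.  So the end-state input may be stated with the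
stabiliser condition at a single vertex (the format of gen 25's `AutChart.criticalProb_lt_one_of_finite_orbits`). [cite: BenjaminiSchramm1996, §2 (almost transitive graphs)] -/
theorem map_stabilizer_eq_one_all (hact : IsActionByAut G A) (hc : G.Connected) (t : V) (c : A →* Multiplicative (Site 2))
    (hc1 : ∀ h ∈ MulAction.stabilizer A t, c h = 1) (w : V) : ∀ h ∈ MulAction.stabilizer A w, c h = 1 := by
  obtain ⟨wk⟩ := hc.preconnected w t
  -- the `c`-value of an element is determined by where it sends `t`
  have hval : ∀ g g' : A, g • t = g' • t → c g = c g' := fun g g' hgg' => by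
    have hst : g'⁻¹ * g ∈ MulAction.stabilizer A t := by
      rw [MulAction.mem_stabilizer_iff, mul_smul, hgg', inv_smul_smul]
    have h1 := hc1 _ hst
    rwa [map_mul, map_inv, inv_mul_eq_one, eq_comm] at h1
  -- representatives of the finitely many possible images of `t` under `Stab(w)`
  have hrep : ∀ u : V, ∃ g : A, (∃ g' : A, g' • t = u) → g • t = u := fun u => by
    by_cases h : ∃ g' : A, g' • t = u
    · obtain ⟨g', hg'⟩ := h; exact ⟨g', fun _ => hg'⟩
    · exact ⟨1, fun h' => absurd h' h⟩
  choose rep hrep using hrep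
  intro h hh
  refine AutPoly.map_eq_one_of_finite_image c (MulAction.stabilizer A w) ?_ hh
  refine (((graphBall_finite G w wk.length).image fun u => c (rep u))).subset ?_
  rintro _ ⟨σ, hσ, rfl⟩
  have hσw : σ • w = w := MulAction.mem_stabilizer_iff.1 hσ
  have hσt : σ • t ∈ graphBall G w wk.length := by
    have h1 := (smul_mem_graphBall_iff hact σ (x := w) (y := t)).2 ⟨wk, le_rfl⟩
    rwa [hσw] at h1
  exact ⟨σ • t, hσt, (hval σ (rep (σ • t)) (hrep (σ • t) ⟨σ, rfl⟩).symm).symm⟩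

/-- **Bounded generation of the kernel for actions with finitely many orbits, off exponential growth of the orbit Rips graph**: `A` acting by automorphisms on
a connected locally finite `G`, every vertex within distance `R` of the orbit of `t`, the orbit Rips graph of `t` at scale `2R+1` growing subexponentially
along every linear scale at its base point, `c : A → ℤ²` killing `Stab(t)` ⟹ `ker c` is generated by its elements moving `t` by at most `M` in `G`.  (Relative
Milnor on the orbit Rips graph, where the action is transitive.) [cite: MilnorSolvableGrowth1968, Lemma 1 pp. 447–448] [cite: BenjaminiSchramm1996, §2 (almost transitive graphs)] -/
theorem ker_eq_closure_bounded_of_cobounded (hact : IsActionByAut G A) (hc : G.Connected) (t : V) {R : ℕ}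
    (hR : ∀ w : V, ∃ a : A, w ∈ graphBall G (a • t) R)
    (hsub : ∀ S : ℕ, 1 ≤ S → ∃ n : ℕ, ballVolume (AutChart.orbitRips G A t (2 * R + 1)) (AutChart.obase A t) (n * S) < 2 ^ n)
    (c : A →* Multiplicative (Site 2)) (hc1 : ∀ h ∈ MulAction.stabilizer A t, c h = 1) :
    ∃ M : ℕ, c.ker = Subgroup.closure {g | g ∈ c.ker ∧ g • t ∈ graphBall G t M} := by
  set m : ℕ := 2 * R + 1 with hm
  have hactH := AutChart.orbitRips_isActionByAut (G := G) (A := A) (t := t) hact m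
  have hcH := AutChart.orbitRips_connected (G := G) (A := A) (t := t) hc hR
  have htrH : ∀ x : MulAction.orbit A t, ∃ a : A, a • AutChart.obase A t = x := AutChart.orbit_transitive
  -- the movers to Rips-neighbours and the stabiliser generate `A`
  have hT := AutChart.closure_movers_eq_top hactH hcH htrH
  have hstab_eq : MulAction.stabilizer A (AutChart.obase A t) = MulAction.stabilizer A t := by
    ext h; exact AutChart.mem_stabilizer_obase_iff h
  rw [hstab_eq] at hT
  have hc1' : ∀ h ∈ MulAction.stabilizer A (AutChart.obase A t), c h = 1 := fun h hh =>
    hc1 h ((AutChart.mem_stabilizer_obase_iff h).1 hh)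
  obtain ⟨M, hM⟩ := AutMilnor.ker_eq_closure_bounded hactH hcH (AutChart.obase A t) hsub _ (by rw [hstab_eq]; exact hT) c hc1'
  refine ⟨M * m, le_antisymm ?_ ?_⟩
  · refine hM.le.trans (Subgroup.closure_mono fun g hg => ⟨hg.1, ?_⟩)
    -- a Rips-ball of radius `M` lies in the `G`-ball of radius `M m`
    have hg2 : ((g • AutChart.obase A t : MulAction.orbit A t) : V) ∈ graphBall G t (M * m) := by
      obtain ⟨w, hw⟩ := hg.2
      have e1 : (Embedding.induce (G := AutMilnor.rips G m) (MulAction.orbit A t : Set V)).toHom (AutChart.obase A t) = t := rfl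
      have e2 : (Embedding.induce (G := AutMilnor.rips G m) (MulAction.orbit A t : Set V)).toHom (g • AutChart.obase A t) =
          ((g • AutChart.obase A t : MulAction.orbit A t) : V) := rfl
      exact AutMilnor.graphBall_rips_subset (G := G) m t M
        ⟨(w.map (Embedding.induce (G := AutMilnor.rips G m) (MulAction.orbit A t : Set V)).toHom).copy e1 e2, by rw [Walk.length_copy, Walk.length_map]; exact hw⟩
    rwa [MulAction.orbit.coe_smul] at hg2
  · exact (Subgroup.closure_le _).2 fun g hg => hg.1

/-- **No exponential growth ⟹ subexponential scales at `t`** for an action with FINITELY MANY orbits (representatives `reps`): if along some scale `R ≥ 1`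
every `2^n ≤ |B(t, nR)|`, then — all vertices being translates of representatives at bounded distance from `t` — `2^n ≤ |B(x, n(R + d))|` at EVERY vertex, i.e.
exponential growth. [cite: Hutchcroft2016, §1 (exponential growth)] [cite: MilnorSolvableGrowth1968, p. 447] -/
theorem subexp_of_not_hasExponentialGrowth (hact : IsActionByAut G A) (hc : G.Connected) (t : V) (reps : Finset V)
    (hreps : ∀ w : V, ∃ a : A, ∃ s ∈ reps, a • s = w) (hG : ¬ HasExponentialGrowth G) :
    ∀ S : ℕ, 1 ≤ S → ∃ n : ℕ, ballVolume G t (n * S) < 2 ^ n := by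
  -- a common bound `d` on the distance from `t` to the representatives
  have hdist : ∀ s : V, ∃ n : ℕ, t ∈ graphBall G s n := fun s => by
    obtain ⟨w⟩ := hc.preconnected s t
    exact ⟨w.length, w, le_rfl⟩
  choose nd hnd using hdist
  set d : ℕ := reps.sup nd with hd
  intro S hS
  by_contra hno
  push Not at hno
  refine hG (Milnor.hasExponentialGrowth_of_two_pow_le G (R := S + d) (by omega) fun x n => ?_)
  obtain ⟨a, s, hs, rfl⟩ := hreps x
  rw [← smulIso_apply hact a s, ballVolume_map_eq]
  -- `B(t, nS) ⊆ B(s, nS + d) ⊆ B(s, n(S + d))` for `n ≥ 1`; `n = 0` is trivial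
  rcases Nat.eq_zero_or_pos n with rfl | hn
  · rw [pow_zero]; exact one_le_ballVolume G s _
  · have hsub : graphBall G t (n * S) ⊆ graphBall G s (n * (S + d)) := fun y hy =>
      graphBall_mono G s (by nlinarith [Finset.le_sup (f := nd) hs]) (mem_graphBall_add G (hnd s) hy)
    exact (hno n).trans (Set.ncard_le_ncard hsub (graphBall_finite G s _))

/-- **THEOREM (unconditional): the END-STATE input has a boundedly generated kernel off exponential growth.**  `A` acting by automorphisms on a connected
locally finite `G` WITHOUT exponential growth, with finitely many orbits; `c : A → ℤ²` killing `Stab(t)` ⟹ `ker c = ⟨{g ∈ ker c : d_G(g • t, t) ≤ M}⟩` for some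
`M`.  (The rank of `c` is irrelevant here; graphs WITH exponential growth are Hutchcroft's and need no node.)
[cite: MilnorSolvableGrowth1968, Lemma 1 pp. 447–448] [cite: BenjaminiSchramm1996, §2 (almost transitive graphs)] [cite: Hutchcroft2016, Thm. 1.1] -/
theorem ker_eq_closure_bounded (hact : IsActionByAut G A) (hc : G.Connected) (t : V) (reps : Finset V)
    (hreps : ∀ w : V, ∃ a : A, ∃ s ∈ reps, a • s = w) (hG : ¬ HasExponentialGrowth G)
    (c : A →* Multiplicative (Site 2)) (hc1 : ∀ h ∈ MulAction.stabilizer A t, c h = 1) :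
    ∃ M : ℕ, c.ker = Subgroup.closure {g | g ∈ c.ker ∧ g • t ∈ graphBall G t M} := by
  -- density radius of the orbit of `t`
  have hdist : ∀ s : V, ∃ n : ℕ, s ∈ graphBall G t n := fun s => by
    obtain ⟨w⟩ := hc.preconnected t s
    exact ⟨w.length, w, le_rfl⟩
  choose nd hnd using hdist
  set R : ℕ := reps.sup nd with hR
  have hdense : ∀ w : V, ∃ a : A, w ∈ graphBall G (a • t) R := fun w => by
    obtain ⟨a, s, hs, rfl⟩ := hreps w
    exact ⟨a, (smul_mem_graphBall_iff hact a).2 (graphBall_mono _ _ (Finset.le_sup (f := nd) hs) (hnd s))⟩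
  refine ker_eq_closure_bounded_of_cobounded hact hc t hdense (fun S hS => ?_) c hc1
  -- subexponential scales pass to the orbit Rips graph: `|B_Rips(t, k)| ≤ |B_G(t, (2R+1) k)|`
  set m : ℕ := 2 * R + 1 with hm
  obtain ⟨n, hn⟩ := subexp_of_not_hasExponentialGrowth hact hc t reps hreps hG (m * S) (by nlinarith)
  refine ⟨n, lt_of_le_of_lt ?_ hn⟩
  have hK : ∀ w : V, ((fun y : MulAction.orbit A t => (y : V)) ⁻¹' {w}).Finite ∧ ((fun y : MulAction.orbit A t => (y : V)) ⁻¹' {w}).ncard ≤ 1 :=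
    fun w => by
      have hsub : ((fun y : MulAction.orbit A t => (y : V)) ⁻¹' {w}).Subsingleton := fun a ha b hb =>
        Subtype.ext ((Set.mem_singleton_iff.1 ha).trans (Set.mem_singleton_iff.1 hb).symm)
      exact ⟨hsub.finite, (Set.ncard_le_one hsub.finite).2 fun a ha b hb => hsub ha hb⟩
  have h1 := GrowthMap.ballVolume_le (H := AutChart.orbitRips G A t m) (G := G) (fun y => (y : V)) AutPoly.orbitRips_adj_walk hK
    (AutChart.obase A t) (n * S)
  rw [one_mul] at h1
  have e : m * (n * S) = n * (m * S) := by ring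
  rw [e] at h1
  exact h1

/-- **… in particular on every graph of POLYNOMIAL growth** (`|B(x,n)| ≤ C (n+1)^D`): the end-state input there (gen 27's `AutPoly.exists_finiteOrbits_rankTwo`,
modulo Trofimov) comes with a boundedly generated kernel, unconditionally. [cite: MilnorSolvableGrowth1968, Lemma 1] [cite: BenjaminiSchramm1996, §2] -/
theorem ker_eq_closure_bounded_of_polynomialGrowth (hact : IsActionByAut G A) (hc : G.Connected) (t : V) (reps : Finset V)
    (hreps : ∀ w : V, ∃ a : A, ∃ s ∈ reps, a • s = w)
    (hpoly : ∃ C D : ℝ, ∀ (x : V) (n : ℕ), (ballVolume G x n : ℝ) ≤ C * ((n : ℝ) + 1) ^ D)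
    (c : A →* Multiplicative (Site 2)) (hc1 : ∀ h ∈ MulAction.stabilizer A t, c h = 1) :
    ∃ M : ℕ, c.ker = Subgroup.closure {g | g ∈ c.ker ∧ g • t ∈ graphBall G t M} :=
  ker_eq_closure_bounded hact hc t reps hreps (not_hasExponentialGrowth_of_polynomialGrowth G t hpoly) c hc1

end EndStateKernel

end Summit.CriticalPhenomena.PercolationContinuityZ3.Theorems.Transplant

end
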